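import Summits.RiemannHypothesis.RiemannHypothesis.Theorems.GroundBartaEvenWinsBeyondArchDeflationRM77ZFinalA
import Summits.RiemannHypothesis.RiemannHypothesis.Theorems.GroundBartaEvenWinsBeyondArchDeflationRM77ZX01SA
import Summits.RiemannHypothesis.RiemannHypothesis.Theorems.GroundBartaEvenWinsBeyondArchDeflationRM77ZX02SA
import Summits.RiemannHypothesis.RiemannHypothesis.Theorems.GroundBartaEvenWinsBeyondArchDeflationRM77ZX12SA
import Summits.RiemannHypothesis.RiemannHypothesis.Theorems.GroundBartaEvenWinsBeyondArchDeflationRM77ZX03SA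
import Summits.RiemannHypothesis.RiemannHypothesis.Theorems.GroundBartaEvenWinsBeyondArchDeflationRM77ZX13SA
import Summits.RiemannHypothesis.RiemannHypothesis.Theorems.GroundBartaEvenWinsBeyondArchDeflationRM77ZX23SA
import Summits.RiemannHypothesis.RiemannHypothesis.Theorems.GroundBartaEvenWinsBeyondArchDeflationM77Final
import Summits.RiemannHypothesis.RiemannHypothesis.Theorems.GroundBartaEvenWinsBeyondArchDeflationCrossGlue2
import HarnessLib

/-!
# RiemannHypothesis / GroundBarta — rung 4 (`EvenWinsBeyondArch`): R-layer certificate of cell M77Y (b = 0.77) — bridge to prover A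

Prover B (speedrun unit `sr-gb-rung-b`, gen 4).  The certified residual norms `z77hs0 … z77hs5` (file `…RM77ZFinalA`) and the
certified cross terms `z77x{ij}_bound` (files `…RM77ZX{ij}SA`, pairs (0,1),(0,2),(1,2),(0,3),(1,3),(2,3)) restated for prover A's
trial vectors `m77v i = dt_wY (m77P i) (77/100)` and window images `m77F` (file `…M77Final`): the hypotheses `hs` and (six of the
fifteen boxes of) `hR` of `dt_m77_oddLower_of_gramT` with `W := z77Wsig`, `s := z77s`, `Rlo/Rhi := z77x..LO/HI`.
-/

set_option linter.dupNamespace false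

noncomputable section

open MeasureTheory Set Filter intervalIntegral
open scoped Topology BigOperators ComplexConjugate

namespace Summit.RiemannHypothesis.RiemannHypothesis.Theorems.EvenWinsBeyondArch

open Literature.NumberTheory.LFunctions
open Literature.Analysis.ValidatedNumerics Literature.Analysis.ValidatedNumerics.PolyMP
  Literature.Analysis.ValidatedNumerics.NumericsMP Literature.Analysis.ValidatedNumerics.ExpPoly

/-- The coefficient matrix of the criterion: `W_il = W̃_il + [l = i] (M̃ − M_(77/100))`. -/
def z77Wsig : Fin 6 → Fin 6 → ℝ := fun i l ↦
  (z77Wd i l : ℝ) + if l = i then (z77Mc : ℝ) - weilMarkovConstant ((77 : ℝ) / 100) else 0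

/-- Prover A's and prover B's copies of the six dyadic vectors are the same lists. -/
theorem z77Pf_eq_m77P : z77Pf = m77P := by
  funext i
  fin_cases i <;> rfl

/-- `m77v l` is the window vector of the certificate. -/
theorem m77v_eq_z77 (l : Fin 6) : m77v l = dt_wY (z77Pf l) z77c := by
  rw [z77Pf_eq_m77P]; rfl

/-- `m77v` in the R-layer's indicator form. -/
theorem m77v_apply_z77 (l : Fin 6) (x : ℝ) :
    m77v l x = (((Icc (-(z77c : ℝ)) z77c).indicator (fun x ↦ Poly.eval (z77gp l) x) x : ℝ) : ℂ) := by
  rw [m77v_eq_z77]; exact z77v_apply l x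

/-- `m77v` in indicator form (R-layer hypothesis `hv`). -/
private theorem hvZ' : ∀ l x, m77v l x = (((Icc (-(z77c : ℝ)) z77c).indicator (fun x ↦ Poly.eval (z77gp l) x) x : ℝ) : ℂ) :=
  m77v_apply_z77

/-- the window constant as a cast. -/
private theorem hcZ : ((z77c : ℚ) : ℝ) = (77 : ℝ) / 100 := by norm_num [z77c]

/-- `m77F` in the R-layer's `hF` form. -/
private theorem hFZ' : ∀ l y, m77F l y = (Icc (-(z77c : ℝ)) z77c).indicator (fun y ↦
        2 * (∫ x, m77v l x * (Real.cosh (x / 2) : ℂ)) * (Real.cosh (y / 2) : ℂ) -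
          2 * (∫ x, m77v l x * (Real.sinh (x / 2) : ℂ)) * (Real.sinh (y / 2) : ℂ) +
        (∑ n ∈ weilPrimeIndex (z77c : ℝ), (((ArithmeticFunction.vonMangoldt n : ℝ) / Real.sqrt n : ℝ) : ℂ) *
          (2 * m77v l y - m77v l (y - Real.log n) - m77v l (y + Real.log n))) +
        ∫ t in Ioi 0, (weilArchDensity t : ℂ) * (2 * m77v l y - m77v l (y - t) - m77v l (y + t))) y -
      (weilMarkovConstant (z77c : ℝ) : ℂ) * m77v l y := by
  intro l y; rw [hcZ]; simp only [m77F]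

/-- alias of `hvZ'`. -/
private theorem hvZ : ∀ l x, m77v l x = (((Icc (-(z77c : ℝ)) z77c).indicator (fun x ↦ Poly.eval (z77gp l) x) x : ℝ) : ℂ) := hvZ'
/-- alias of `hFZ'`. -/
private theorem hFZ : ∀ l y, m77F l y = (Icc (-(z77c : ℝ)) z77c).indicator (fun y ↦
        2 * (∫ x, m77v l x * (Real.cosh (x / 2) : ℂ)) * (Real.cosh (y / 2) : ℂ) -
          2 * (∫ x, m77v l x * (Real.sinh (x / 2) : ℂ)) * (Real.sinh (y / 2) : ℂ) +
        (∑ n ∈ weilPrimeIndex (z77c : ℝ), (((ArithmeticFunction.vonMangoldt n : ℝ) / Real.sqrt n : ℝ) : ℂ) *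
          (2 * m77v l y - m77v l (y - Real.log n) - m77v l (y + Real.log n))) +
        ∫ t in Ioi 0, (weilArchDensity t : ℂ) * (2 * m77v l y - m77v l (y - t) - m77v l (y + t))) y -
      (weilMarkovConstant (z77c : ℝ) : ℂ) * m77v l y := hFZ'

/-- The criterion matrix in the R-layer's generic form. -/
private theorem hW (i : Fin 6) : (fun l ↦ ((z77Wd i l : ℝ) + if l = i then (z77Mc : ℝ) - weilMarkovConstant (z77c : ℝ) else 0) • m77v l) =
    fun l ↦ z77Wsig i l • m77v l := by
  funext l; rw [hcZ]; rfl

/-- **The residual norm bounds in prover A's vocabulary** (hypothesis `hs` of `dt_m77_oddLower_of_gramT` with `W := z77Wsig`,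
`s i := z77s i`). [cite: Bombieri2000Weil, Thm 2] -/
theorem z77hs_m77 : ∀ i : Fin 6, ∫ x, ‖(m77F i - ∑ l, z77Wsig i l • m77v l) x‖ ^ 2 ≤ ((z77s i : ℚ) : ℝ) := by
  have hF : ∀ l y, m77F l y = (Icc (-((77 : ℝ) / 100)) ((77 : ℝ) / 100)).indicator (fun y ↦
        2 * (∫ x, dt_wY (z77Pf l) z77c x * (Real.cosh (x / 2) : ℂ)) * (Real.cosh (y / 2) : ℂ) -
          2 * (∫ x, dt_wY (z77Pf l) z77c x * (Real.sinh (x / 2) : ℂ)) * (Real.sinh (y / 2) : ℂ) +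
        (∑ n ∈ weilPrimeIndex ((77 : ℝ) / 100), (((ArithmeticFunction.vonMangoldt n : ℝ) / Real.sqrt n : ℝ) : ℂ) *
          (2 * dt_wY (z77Pf l) z77c y - dt_wY (z77Pf l) z77c (y - Real.log n) - dt_wY (z77Pf l) z77c (y + Real.log n))) +
        ∫ t in Ioi 0, (weilArchDensity t : ℂ) * (2 * dt_wY (z77Pf l) z77c y - dt_wY (z77Pf l) z77c (y - t) - dt_wY (z77Pf l) z77c (y + t))) y -
      (weilMarkovConstant ((77 : ℝ) / 100) : ℂ) * dt_wY (z77Pf l) z77c y := by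
    intro l y
    simp only [m77F, m77v_eq_z77]
  have hW' : ∀ i, (fun l ↦ z77Wsig i l • m77v l) =
      fun l ↦ ((z77Wd i l : ℝ) + if l = i then (z77Mc : ℝ) - weilMarkovConstant ((77 : ℝ) / 100) else 0) • dt_wY (z77Pf l) z77c := by
    intro i; funext l; rw [m77v_eq_z77]; rfl
  intro i
  fin_cases i
  · simp only [hW']; exact z77hs0 m77F hF
  · simp only [hW']; exact z77hs1 m77F hF
  · simp only [hW']; exact z77hs2 m77F hF
  · simp only [hW']; exact z77hs3 m77F hF
  · simp only [hW']; exact z77hs4 m77F hF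
  · simp only [hW']; exact z77hs5 m77F hF

/-- Cross term (0,1) in prover A's vocabulary (`∫ Re`, `m77F`, `m77v`, `W := z77Wsig`). -/
theorem z77hc01_m77 :
    ((z77x01LO : ℚ) : ℝ) ≤ ∫ x, ((m77F 0 - ∑ l, z77Wsig 0 l • m77v l) x * conj ((m77F 1 - ∑ l, z77Wsig 1 l • m77v l) x)).re ∧
      ∫ x, ((m77F 0 - ∑ l, z77Wsig 0 l • m77v l) x * conj ((m77F 1 - ∑ l, z77Wsig 1 l • m77v l) x)).re ≤ ((z77x01HI : ℚ) : ℝ) := by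
  have h := z77x01_bound m77v m77F hvZ hFZ
  rw [hW 0, hW 1] at h
  rw [dt_cross_integral_re_L (gp := z77gp) (by norm_num [z77c]) hvZ' hFZ' z77Wsig 0 1]
  exact h

/-- Cross term (0,2) in prover A's vocabulary (`∫ Re`, `m77F`, `m77v`, `W := z77Wsig`). -/
theorem z77hc02_m77 :
    ((z77x02LO : ℚ) : ℝ) ≤ ∫ x, ((m77F 0 - ∑ l, z77Wsig 0 l • m77v l) x * conj ((m77F 2 - ∑ l, z77Wsig 2 l • m77v l) x)).re ∧
      ∫ x, ((m77F 0 - ∑ l, z77Wsig 0 l • m77v l) x * conj ((m77F 2 - ∑ l, z77Wsig 2 l • m77v l) x)).re ≤ ((z77x02HI : ℚ) : ℝ) := by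
  have h := z77x02_bound m77v m77F hvZ hFZ
  rw [hW 0, hW 2] at h
  rw [dt_cross_integral_re_L (gp := z77gp) (by norm_num [z77c]) hvZ' hFZ' z77Wsig 0 2]
  exact h

/-- Cross term (1,2) in prover A's vocabulary (`∫ Re`, `m77F`, `m77v`, `W := z77Wsig`). -/
theorem z77hc12_m77 :
    ((z77x12LO : ℚ) : ℝ) ≤ ∫ x, ((m77F 1 - ∑ l, z77Wsig 1 l • m77v l) x * conj ((m77F 2 - ∑ l, z77Wsig 2 l • m77v l) x)).re ∧
      ∫ x, ((m77F 1 - ∑ l, z77Wsig 1 l • m77v l) x * conj ((m77F 2 - ∑ l, z77Wsig 2 l • m77v l) x)).re ≤ ((z77x12HI : ℚ) : ℝ) := by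
  have h := z77x12_bound m77v m77F hvZ hFZ
  rw [hW 1, hW 2] at h
  rw [dt_cross_integral_re_L (gp := z77gp) (by norm_num [z77c]) hvZ' hFZ' z77Wsig 1 2]
  exact h

/-- Cross term (0,3) in prover A's vocabulary (`∫ Re`, `m77F`, `m77v`, `W := z77Wsig`). -/
theorem z77hc03_m77 :
    ((z77x03LO : ℚ) : ℝ) ≤ ∫ x, ((m77F 0 - ∑ l, z77Wsig 0 l • m77v l) x * conj ((m77F 3 - ∑ l, z77Wsig 3 l • m77v l) x)).re ∧
      ∫ x, ((m77F 0 - ∑ l, z77Wsig 0 l • m77v l) x * conj ((m77F 3 - ∑ l, z77Wsig 3 l • m77v l) x)).re ≤ ((z77x03HI : ℚ) : ℝ) := by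
  have h := z77x03_bound m77v m77F hvZ hFZ
  rw [hW 0, hW 3] at h
  rw [dt_cross_integral_re_L (gp := z77gp) (by norm_num [z77c]) hvZ' hFZ' z77Wsig 0 3]
  exact h

/-- Cross term (1,3) in prover A's vocabulary (`∫ Re`, `m77F`, `m77v`, `W := z77Wsig`). -/
theorem z77hc13_m77 :
    ((z77x13LO : ℚ) : ℝ) ≤ ∫ x, ((m77F 1 - ∑ l, z77Wsig 1 l • m77v l) x * conj ((m77F 3 - ∑ l, z77Wsig 3 l • m77v l) x)).re ∧
      ∫ x, ((m77F 1 - ∑ l, z77Wsig 1 l • m77v l) x * conj ((m77F 3 - ∑ l, z77Wsig 3 l • m77v l) x)).re ≤ ((z77x13HI : ℚ) : ℝ) := by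
  have h := z77x13_bound m77v m77F hvZ hFZ
  rw [hW 1, hW 3] at h
  rw [dt_cross_integral_re_L (gp := z77gp) (by norm_num [z77c]) hvZ' hFZ' z77Wsig 1 3]
  exact h

/-- Cross term (2,3) in prover A's vocabulary (`∫ Re`, `m77F`, `m77v`, `W := z77Wsig`). -/
theorem z77hc23_m77 :
    ((z77x23LO : ℚ) : ℝ) ≤ ∫ x, ((m77F 2 - ∑ l, z77Wsig 2 l • m77v l) x * conj ((m77F 3 - ∑ l, z77Wsig 3 l • m77v l) x)).re ∧
      ∫ x, ((m77F 2 - ∑ l, z77Wsig 2 l • m77v l) x * conj ((m77F 3 - ∑ l, z77Wsig 3 l • m77v l) x)).re ≤ ((z77x23HI : ℚ) : ℝ) := by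
  have h := z77x23_bound m77v m77F hvZ hFZ
  rw [hW 2, hW 3] at h
  rw [dt_cross_integral_re_L (gp := z77gp) (by norm_num [z77c]) hvZ' hFZ' z77Wsig 2 3]
  exact h

/-- Conjugation symmetry, for the transposed pairs. -/
theorem z77hc_symm (i j : Fin 6) :
    ∫ x, ((m77F j - ∑ l, z77Wsig j l • m77v l) x * conj ((m77F i - ∑ l, z77Wsig i l • m77v l) x)).re = ∫ x, ((m77F i - ∑ l, z77Wsig i l • m77v l) x * conj ((m77F j - ∑ l, z77Wsig j l • m77v l) x)).re := by
  rw [dt_cross_integral_re_L (gp := z77gp) (by norm_num [z77c]) hvZ' hFZ' z77Wsig j i,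
    dt_cross_integral_re_L (gp := z77gp) (by norm_num [z77c]) hvZ' hFZ' z77Wsig i j, dt_cross_re_symm]

end Summit.RiemannHypothesis.RiemannHypothesis.Theorems.EvenWinsBeyondArch

end
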